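import Literature.Topology.FourManifolds.SeifertSheetLevelFn
import Mathlib.Topology.MetricSpace.HausdorffDistance
import HarnessLib

/-!
# The open Seifert surface of the knot and its band: a bicollar of variable width

Topic `Literature/Topology/FourManifolds`; second step of the bicollar of a Seifert surface
(after `SeifertSheetLevelFn.lean`). Let `D` be a Seifert datum of the knot `K` and
`U : LevelUnitField 2 D.sphereLevelFn 0` a unit-speed field across the closed-up level surface
`Λ = K ∪ θ⁻¹{±v}` (which exists, `SeifertDatum.nonempty_levelUnitField`); its global flow `U.fl`
on `𝕊³` sweeps out the product neighbourhood `Λ × (-δ, δ) ≅ f⁻¹(-δ, δ)` of `Λ` (Milnor 1963,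
Thm. 3.1; the tree's `RegularLevelCollar.lean`: the clock `f (fl y s) = s`, the drop `drop` onto
`Λ`).

* **The open Seifert surface** `D.surf ⊆ 𝕊³ ∖ K` (Rolfsen 1976, §5.A; Juhász 2023, Def. 4.8:
  a Seifert surface has no closed components): the path component of the point
  `p₁ = ν (x₀, v/2)` of the meridian circle in `Λ ∖ K`. It lies in `θ⁻¹{v}`
  (`θhat_eq_of_mem_surf`), is path connected, is open in `Λ` (`exists_isOpen_inter_sheet_eq_surf`:
  `Λ` is a surface, hence locally path connected) and closed in `Λ ∖ K`, so that
  `closure surf ⊆ surf ∪ K` (`closure_surf_subset`).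
* **The band of variable width** about it: with the width `w = (δ/2) · min(dist(·, K), 1)`,
  vanishing exactly on the knot, `D.band U = {q ∈ f⁻¹(-δ, δ) | drop q ∈ surf, |f q| < w (drop q)}`
  is an open subset of the knot complement (`isOpen_band`, `band_subset_compl_range`), and
  **`(y, t) ↦ fl y (t · w y)` is a homeomorphism `surf × (-1, 1) ≃ₜ band`** (`bandHomeomorph`)
  with inverse `q ↦ (drop q, f q / w (drop q))`. Near the knot the band is the wedge
  `{|f| < w}` pinched along `K`, so that — unlike a band of constant width, whose closure contains
  the flow-out of `K` — its frontier in `𝕊³ ∖ K` lies in `{|f| = w ∘ drop}`: the key to the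
  continuity of the circle-valued map of the next file is `image_bandMap_closure_subset`
  (the flow-out of `closure surf × [-(1-ε), 1-ε]`, a compact set, meets the knot complement
  inside the band).

Everything is proved; no named fact is introduced.

## References

* J. Milnor, *Morse theory*, Ann. of Math. Studies 51 (1963), Thm. 3.1. [Milnor1963]
* D. Rolfsen, *Knots and Links*, Publish or Perish (1976), §5.A (bicollared surfaces), §5.C.
  [Rolfsen1976]
* A. Juhász, *Differential and Low-Dimensional Topology* (2023), Def. 4.8, Prop. 4.10. [Juhasz2023]
-/

open scoped Manifold ContDiff Topology RealInnerProductSpace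
open Function Set Filter Metric

noncomputable section

namespace Literature.Topology.FourManifolds

/-- Local notation: `𝔼 n` is the model Euclidean space `EuclideanSpace ℝ (Fin n)`. -/
local notation "𝔼 " n:arg => EuclideanSpace ℝ (Fin n)

/-- Local notation: `𝕊 n` is the unit sphere in `EuclideanSpace ℝ (Fin (n + 1))`. -/
local notation "𝕊 " n:arg => (Metric.sphere (0 : EuclideanSpace ℝ (Fin (n + 1))) 1)

namespace SeifertDatum

open scoped Classical

variable {K : Knot} (D : SeifertDatum K)

/-! ### The sheet is closed; the base point of the meridian circle on it -/

/-- `Λ` is closed in `𝕊³` (the zero set of the level function). [folklore] -/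
theorem isClosed_sheet : IsClosed D.sheet := by
  rw [← D.sphereLevelFn_preimage_zero]
  exact isClosed_singleton.preimage D.continuous_sphereLevelFn

/-- `Λ` is compact. [folklore] -/
theorem isCompact_sheet : IsCompact D.sheet := D.isClosed_sheet.isCompact

/-- **The base point** `p₁ = ν (x₀, v/2)`: the point of the meridian circle of `ν` (radius `1/2`
over `x₀ = circlePoint 0`) at the angle `v`. [folklore] -/
def basePt : 𝕊 3 := D.ν (circlePoint 0, (1 / 2 : ℝ) • (D.v : 𝔼 2))

/-- `v/2 ≠ 0`. [folklore] -/
theorem half_v_ne_zero : (1 / 2 : ℝ) • (D.v : 𝔼 2) ≠ 0 :=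
  smul_ne_zero (by norm_num) D.v_ne_zero

/-- `‖v/2‖ = 1/2`. [folklore] -/
theorem norm_half_v : ‖(1 / 2 : ℝ) • (D.v : 𝔼 2)‖ = 1 / 2 := by
  rw [norm_smul, D.norm_v, mul_one, Real.norm_eq_abs, abs_of_pos (by norm_num)]

/-- The base point is off the knot. [folklore] -/
theorem basePt_not_mem_range : D.basePt ∉ range ⇑K := D.ν.apply_mem_compl_range D.half_v_ne_zero

/-- At the base point `θ = v`. [folklore] -/
theorem θhat_basePt : D.θhat D.basePt = (D.v : 𝔼 2) := by
  rw [basePt, D.θhat_tube _ D.half_v_ne_zero (by rw [D.norm_half_v]; norm_num), D.norm_half_v,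
    smul_smul]
  norm_num

/-- The base point lies on `Λ`. [folklore] -/
theorem basePt_mem_sheet : D.basePt ∈ D.sheet := Or.inr (Or.inl D.θhat_basePt)

/-! ### The open Seifert surface: the path component of the base point in `Λ ∖ K` -/

/-- The base point as a point of the surface `Λ`. [folklore] -/
def basePt' : D.Sheet := ⟨D.basePt, D.basePt_mem_sheet⟩

/-- `Λ ∖ K` inside the surface `Λ`. [folklore] -/
def offKnot : Set D.Sheet := {p | p.1 ∉ range ⇑K}

/-- `Λ ∖ K` is open in `Λ`. [folklore] -/
theorem isOpen_offKnot : IsOpen D.offKnot :=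
  (K.isClosed_range.preimage continuous_subtype_val).isOpen_compl

/-- The path component of the base point in `Λ ∖ K`, inside the surface `Λ`. [folklore] -/
def surf' : Set D.Sheet := pathComponentIn D.offKnot D.basePt'

/-- **The open Seifert surface** `F° ⊆ 𝕊³`: the path component of `p₁` in `Λ ∖ K`.
[cite: Rolfsen1976, §5.A] -/
def surf : Set (𝕊 3) := D.sheetIncl '' D.surf'

/-- The inclusion `Λ ↪ 𝕊³` is a closed embedding. [folklore] -/
theorem isClosedEmbedding_sheetIncl : Topology.IsClosedEmbedding D.sheetIncl := by
  refine ⟨D.isSmoothEmbedding_sheetIncl.isEmbedding, ?_⟩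
  have : range D.sheetIncl = D.sheet := by
    ext p
    exact ⟨by rintro ⟨q, rfl⟩; exact q.2, fun hp => ⟨⟨p, hp⟩, rfl⟩⟩
  rw [this]
  exact D.isClosed_sheet

/-- `Λ` is locally path connected (a surface). [folklore] -/
instance instLocallyPathConnectedSpaceSheet : LocallyPathConnectedSpace D.Sheet :=
  ChartedSpace.locallyPathConnectedSpace (𝔼 2) D.Sheet

/-- `F°` (in `Λ`) is open in `Λ`. [folklore] -/
theorem isOpen_surf' : IsOpen D.surf' := D.isOpen_offKnot.pathComponentIn _

/-- `F°` (in `Λ`) is closed in `Λ ∖ K`: a point of `Λ ∖ K` in its closure belongs to it (join it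
to a nearby point of `F°` inside a path-connected neighbourhood contained in `Λ ∖ K`). [folklore] -/
theorem closure_surf'_inter_offKnot_subset : closure D.surf' ∩ D.offKnot ⊆ D.surf' := by
  rintro y ⟨hyc, hyo⟩
  obtain ⟨V, ⟨hVy, hVc⟩, hVo⟩ :=
    (path_connected_basis y).mem_iff.1 (D.isOpen_offKnot.mem_nhds hyo)
  obtain ⟨z, hzV, hzs⟩ := mem_closure_iff_nhds.1 hyc V hVy
  have hyz : JoinedIn D.offKnot z y :=
    ((hVc.joinedIn z hzV y (mem_of_mem_nhds hVy)).mono hVo)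
  exact hzs.trans hyz

/-- `F° ⊆ Λ`. [folklore] -/
theorem surf_subset_sheet : D.surf ⊆ D.sheet := by
  rintro _ ⟨p, -, rfl⟩; exact p.2

/-- `F°` misses the knot. [folklore] -/
theorem surf_subset_compl_range : D.surf ⊆ (range ⇑K)ᶜ := by
  rintro _ ⟨p, hp, rfl⟩
  exact (pathComponentIn_subset (F := D.offKnot) hp : p ∈ D.offKnot)

/-- The base point lies on `F°`. [folklore] -/
theorem basePt_mem_surf : D.basePt ∈ D.surf :=
  ⟨D.basePt', mem_pathComponentIn_self (show D.basePt'.1 ∉ range ⇑K from D.basePt_not_mem_range), rfl⟩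

/-- **`F°` is path connected.** [folklore] -/
theorem isPathConnected_surf : IsPathConnected D.surf :=
  (isPathConnected_pathComponentIn
    (show D.basePt' ∈ D.offKnot from D.basePt_not_mem_range)).image
      D.isClosedEmbedding_sheetIncl.continuous

/-- **`F°` is open in `Λ`**: `F° = O ∩ Λ` for an open `O ⊆ 𝕊³`. [folklore] -/
theorem exists_isOpen_inter_sheet_eq_surf : ∃ O : Set (𝕊 3), IsOpen O ∧ O ∩ D.sheet = D.surf := by
  obtain ⟨O, hO, hOe⟩ := isOpen_induced_iff.1 D.isOpen_surf'
  refine ⟨O, hO, Set.ext fun p => ⟨fun ⟨hpO, hps⟩ => ⟨⟨p, hps⟩, ?_, rfl⟩, ?_⟩⟩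
  · rw [← hOe]; exact hpO
  · rintro ⟨q, hq, rfl⟩
    rw [← hOe] at hq
    exact ⟨hq, q.2⟩

/-- **`closure F° ⊆ F° ∪ K`.** [folklore] -/
theorem closure_surf_subset : closure D.surf ⊆ D.surf ∪ range ⇑K := by
  intro q hq
  by_cases hK : q ∈ range ⇑K
  · exact Or.inr hK
  · left
    have h1 : closure D.surf = D.sheetIncl '' closure D.surf' :=
      D.isClosedEmbedding_sheetIncl.closure_image_eq D.surf'
    rw [h1] at hq
    obtain ⟨p, hp, rfl⟩ := hq
    exact ⟨p, D.closure_surf'_inter_offKnot_subset ⟨hp, hK⟩, rfl⟩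

/-- **On `F°`, `θ = v`**: along a path in `Λ ∖ K` from `p₁` the continuous function `⟪θ, v⟫` takes
values in `{1, -1}` and starts at `1`. [folklore] -/
theorem θhat_eq_of_mem_surf {p : 𝕊 3} (hp : p ∈ D.surf) : D.θhat p = (D.v : 𝔼 2) := by
  obtain ⟨q, hq, rfl⟩ := hp
  obtain ⟨γ, hγ⟩ := (hq : JoinedIn D.offKnot D.basePt' q)
  -- the function `t ↦ ⟪θ (γ t), v⟫`
  set g : unitInterval → ℝ := fun t => ⟪D.θhat (γ t).1, (D.v : 𝔼 2)⟫ with hg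
  have hval : ∀ t, D.θhat (γ t).1 = (D.v : 𝔼 2) ∨ D.θhat (γ t).1 = -(D.v : 𝔼 2) := fun t =>
    (or_iff_right (hγ t)).1 (γ t).2
  have hgval : ∀ t, g t = 1 ∨ g t = -1 := fun t => by
    rcases hval t with h | h
    · left; rw [hg]; simp only; rw [h, real_inner_self_eq_norm_sq, D.norm_v]; norm_num
    · right; rw [hg]; simp only; rw [h, inner_neg_left, real_inner_self_eq_norm_sq, D.norm_v]; norm_num
  have hgc : Continuous g := by
    have h1 : Continuous fun t => (γ t).1 := continuous_subtype_val.comp γ.continuous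
    have h2 : ContinuousOn D.θhat (range ⇑K)ᶜ := D.continuousOn_θhat
    exact (h2.comp_continuous h1 fun t => hγ t).inner continuous_const
  have hg0 : g 0 = 1 := by
    rw [hg]; simp only; rw [γ.source]
    change ⟪D.θhat D.basePt, (D.v : 𝔼 2)⟫ = 1
    rw [D.θhat_basePt, real_inner_self_eq_norm_sq, D.norm_v]; norm_num
  -- by connectedness `g 1 = 1`
  have hg1 : g 1 = 1 := by
    rcases hgval 1 with h | h
    · exact h
    · exfalso
      have hmem : (0 : ℝ) ∈ Icc (g 1) (g 0) := by rw [h, hg0]; norm_num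
      obtain ⟨t, -, ht⟩ := intermediate_value_Icc' zero_le_one hgc.continuousOn hmem
      rcases hgval t with h' | h' <;> linarith
  rcases hval 1 with h | h
  · rw [γ.target] at h; exact h
  · exfalso
    have : g 1 = -1 := by
      rw [hg]; simp only; rw [h, inner_neg_left, real_inner_self_eq_norm_sq, D.norm_v]; norm_num
    linarith

/-- `F°` lies in the knot complement and in `θ⁻¹{v}`; in particular the level function vanishes
on it. [folklore] -/
theorem sphereLevelFn_eq_zero_of_mem_surf {p : 𝕊 3} (hp : p ∈ D.surf) : D.sphereLevelFn p = 0 :=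
  (D.sphereLevelFn_eq_zero_iff p).2 (D.surf_subset_sheet hp)

/-! ### The width function -/

variable (U : LevelUnitField 2 D.sphereLevelFn 0)

/-- **The width of the band**: `w = (δ/2) · min(dist(·, K), 1)`. [folklore] -/
def width (p : 𝕊 3) : ℝ := U.δ / 2 * min (infDist p (range ⇑K)) 1

/-- The width is continuous. [folklore] -/
theorem continuous_width : Continuous (D.width U) :=
  continuous_const.mul ((continuous_infDist_pt _).min continuous_const)

/-- The width is nonnegative. [folklore] -/
theorem width_nonneg (p : 𝕊 3) : 0 ≤ D.width U p :=
  mul_nonneg (by linarith [U.δ_pos]) (le_min infDist_nonneg zero_le_one)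

/-- The width is at most `δ/2`. [folklore] -/
theorem width_le (p : 𝕊 3) : D.width U p ≤ U.δ / 2 := by
  have h : min (infDist p (range ⇑K)) 1 ≤ 1 := min_le_right _ _
  have hδ : 0 ≤ U.δ / 2 := by linarith [U.δ_pos]
  calc D.width U p = U.δ / 2 * min (infDist p (range ⇑K)) 1 := rfl
    _ ≤ U.δ / 2 * 1 := mul_le_mul_of_nonneg_left h hδ
    _ = U.δ / 2 := mul_one _

/-- The width is less than `δ`. [folklore] -/
theorem width_lt (p : 𝕊 3) : D.width U p < U.δ := by linarith [D.width_le U p, U.δ_pos]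

/-- **The width vanishes exactly on the knot.** [folklore] -/
theorem width_eq_zero_iff (p : 𝕊 3) : D.width U p = 0 ↔ p ∈ range ⇑K := by
  have hne : (range ⇑K).Nonempty := range_nonempty _
  rw [width, mul_eq_zero, or_iff_right (by linarith [U.δ_pos] : U.δ / 2 ≠ 0),
    K.isClosed_range.mem_iff_infDist_zero hne]
  constructor
  · intro h
    have h0 := infDist_nonneg (x := p) (s := range ⇑K)
    rcases min_choice (infDist p (range ⇑K)) 1 with h' | h'
    · rw [h'] at h; exact h
    · rw [h'] at h; exact absurd h one_ne_zero
  · intro h; rw [h, min_eq_left zero_le_one]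

/-- Off the knot the width is positive. [folklore] -/
theorem width_pos {p : 𝕊 3} (hp : p ∉ range ⇑K) : 0 < D.width U p :=
  lt_of_le_of_ne (D.width_nonneg U p) fun h => hp ((D.width_eq_zero_iff U p).1 h.symm)

/-- Times of modulus at most `1` scaled by the width stay in `(-δ, δ)`. [folklore] -/
theorem mul_width_mem_Ioo {t : ℝ} (ht : |t| ≤ 1) (p : 𝕊 3) : t * D.width U p ∈ Ioo (-U.δ) U.δ := by
  have h1 : |t * D.width U p| ≤ D.width U p := by
    rw [abs_mul, abs_of_nonneg (D.width_nonneg U p)]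
    exact mul_le_of_le_one_left (D.width_nonneg U p) ht
  have h2 := D.width_lt U p
  rw [abs_le] at h1
  exact ⟨by linarith [h1.1], by linarith [h1.2]⟩

/-! ### The band map and the band -/

/-- **The band map** `Ψ̂ (y, t) = fl y (t · w y)`. [folklore] -/
def bandMap (y : 𝕊 3) (t : ℝ) : 𝕊 3 := U.fl y (t * D.width U y)

/-- The band map is continuous. [folklore] -/
theorem continuous_bandMap : Continuous fun p : (𝕊 3) × ℝ => D.bandMap U p.1 p.2 :=
  U.continuous_fl.comp (continuous_fst.prodMk (continuous_snd.mul ((D.continuous_width U).comp continuous_fst)))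

/-- **The clock along the band map**: `f (Ψ̂ (y, t)) = t · w y` for `y ∈ Λ`, `|t| ≤ 1`. [folklore] -/
theorem sphereLevelFn_bandMap {y : 𝕊 3} (hy : D.sphereLevelFn y = 0) {t : ℝ} (ht : |t| ≤ 1) :
    D.sphereLevelFn (D.bandMap U y t) = t * D.width U y := by
  rw [bandMap, U.apply_fl_of_apply_eq hy (D.mul_width_mem_Ioo U ht y), zero_add]

/-- **The drop of the band map**: `drop (Ψ̂ (y, t)) = y` for `y ∈ Λ`, `|t| ≤ 1`. [folklore] -/
theorem drop_bandMap {y : 𝕊 3} (hy : D.sphereLevelFn y = 0) {t : ℝ} (ht : |t| ≤ 1) :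
    U.drop (D.bandMap U y t) = y :=
  U.drop_fl_of_apply_eq hy (D.mul_width_mem_Ioo U ht y)

/-- On the knot the band map is constant in time (width `0`). [folklore] -/
theorem bandMap_of_mem_range {y : 𝕊 3} (hy : y ∈ range ⇑K) (t : ℝ) : D.bandMap U y t = y := by
  rw [bandMap, (D.width_eq_zero_iff U y).2 hy, mul_zero]
  exact U.fl_zero y

/-- **The band** `N = {q ∈ f⁻¹(-δ, δ) | drop q ∈ F°, |f q| < w (drop q)}`. [cite: Rolfsen1976, §5.A] -/
def band : Set (𝕊 3) :=
  {q | q ∈ U.band ∧ U.drop q ∈ D.surf ∧ |D.sphereLevelFn q| < D.width U (U.drop q)}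

/-- **The band is open.** [folklore] -/
theorem isOpen_band : IsOpen (D.band U) := by
  obtain ⟨O, hO, hOe⟩ := D.exists_isOpen_inter_sheet_eq_surf
  have h1 : D.band U = U.band ∩ (U.drop ⁻¹' O) ∩
      {q | |D.sphereLevelFn q| < D.width U (U.drop q)} := by
    ext q
    simp only [band, mem_setOf_eq, mem_inter_iff, mem_preimage]
    constructor
    · rintro ⟨hb, hs, hw⟩
      rw [← hOe] at hs
      exact ⟨⟨hb, hs.1⟩, hw⟩
    · rintro ⟨⟨hb, hO'⟩, hw⟩
      refine ⟨hb, ?_, hw⟩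
      rw [← hOe]
      exact ⟨hO', (D.sphereLevelFn_eq_zero_iff _).1 (U.apply_drop hb)⟩
  rw [h1]
  exact (U.isOpen_band.inter (hO.preimage U.continuous_drop)).inter
    (isOpen_lt (continuous_abs.comp D.continuous_sphereLevelFn)
      ((D.continuous_width U).comp U.continuous_drop))

/-- **The band misses the knot.** [folklore] -/
theorem band_subset_compl_range : D.band U ⊆ (range ⇑K)ᶜ := by
  rintro q ⟨-, hs, hw⟩ hq
  have h0 : D.sphereLevelFn q = 0 := D.sphereLevelFn_eq_zero_of_mem_range hq
  have hd : U.drop q = q := U.drop_of_apply_eq h0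
  rw [hd] at hs
  exact D.surf_subset_compl_range hs hq

/-- Points of `F°` flow into the band for times `|t| < 1`. [folklore] -/
theorem bandMap_mem_band {y : 𝕊 3} (hy : y ∈ D.surf) {t : ℝ} (ht : |t| < 1) :
    D.bandMap U y t ∈ D.band U := by
  have hy0 := D.sphereLevelFn_eq_zero_of_mem_surf hy
  have hyK : y ∉ range ⇑K := D.surf_subset_compl_range hy
  refine ⟨?_, ?_, ?_⟩
  · exact U.fl_mem_band hy0 (D.mul_width_mem_Ioo U ht.le y)
  · rw [D.drop_bandMap U hy0 ht.le]; exact hy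
  · rw [D.sphereLevelFn_bandMap U hy0 ht.le, D.drop_bandMap U hy0 ht.le, abs_mul,
      abs_of_nonneg (D.width_nonneg U y)]
    exact mul_lt_of_lt_one_left (D.width_pos U hyK) ht

/-- **The band map recovers every point of the band** from its drop and its height:
`Ψ̂ (drop q, f q / w (drop q)) = q`. [folklore] -/
theorem bandMap_drop {q : 𝕊 3} (hq : q ∈ D.band U) :
    D.bandMap U (U.drop q) (D.sphereLevelFn q / D.width U (U.drop q)) = q := by
  have hw : 0 < D.width U (U.drop q) := D.width_pos U (D.surf_subset_compl_range hq.2.1)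
  rw [bandMap, div_mul_cancel₀ _ hw.ne']
  have := U.fl_drop q
  rwa [sub_zero] at this

/-- The normalised height `f q / w (drop q)` of a point of the band lies in `(-1, 1)`. [folklore] -/
theorem abs_div_width_lt_one {q : 𝕊 3} (hq : q ∈ D.band U) :
    |D.sphereLevelFn q / D.width U (U.drop q)| < 1 := by
  have hw : 0 < D.width U (U.drop q) := D.width_pos U (D.surf_subset_compl_range hq.2.1)
  rw [abs_div, abs_of_pos hw, div_lt_one hw]
  exact hq.2.2

/-! ### The homeomorphism `F° × (-1, 1) ≃ₜ N` -/

/-- **The band is homeomorphic to `F° × (-1, 1)`** by `(y, t) ↦ fl y (t · w y)`, with inverse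
`q ↦ (drop q, f q / w (drop q))`. [cite: Rolfsen1976, §5.A] -/
def bandHomeomorph : ↥D.surf × Ioo (-1 : ℝ) 1 ≃ₜ ↥(D.band U) where
  toFun p := ⟨D.bandMap U p.1 p.2, D.bandMap_mem_band U p.1.2 (abs_lt.2 p.2.2)⟩
  invFun q := (⟨U.drop q, q.2.2.1⟩, ⟨D.sphereLevelFn q / D.width U (U.drop q),
    abs_lt.1 (D.abs_div_width_lt_one U q.2)⟩)
  left_inv p := by
    obtain ⟨⟨y, hy⟩, ⟨t, ht⟩⟩ := p
    have hy0 := D.sphereLevelFn_eq_zero_of_mem_surf hy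
    have ht' : |t| ≤ 1 := (abs_lt.2 ht).le
    have hw : 0 < D.width U y := D.width_pos U (D.surf_subset_compl_range hy)
    refine Prod.ext (Subtype.ext ?_) (Subtype.ext ?_)
    · exact D.drop_bandMap U hy0 ht'
    · change D.sphereLevelFn (D.bandMap U y t) / D.width U (U.drop (D.bandMap U y t)) = t
      rw [D.drop_bandMap U hy0 ht', D.sphereLevelFn_bandMap U hy0 ht', mul_div_cancel_right₀ _ hw.ne']
  right_inv q := Subtype.ext (D.bandMap_drop U q.2)
  continuous_toFun := by
    refine Continuous.subtype_mk ?_ _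
    exact (D.continuous_bandMap U).comp
      ((continuous_subtype_val.comp continuous_fst).prodMk (continuous_subtype_val.comp continuous_snd))
  continuous_invFun := by
    have hval : Continuous fun q : ↥(D.band U) => (q : 𝕊 3) := continuous_subtype_val
    refine (Continuous.subtype_mk (U.continuous_drop.comp hval) _).prodMk
      (Continuous.subtype_mk ?_ _)
    refine (D.continuous_sphereLevelFn.comp hval).div
      ((D.continuous_width U).comp (U.continuous_drop.comp hval)) fun q => ?_
    exact (D.width_pos U (D.surf_subset_compl_range q.2.2.1)).ne'

/-- The band homeomorphism as a map to `𝕊³`. [folklore] -/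
@[simp] theorem bandHomeomorph_apply_coe (p : ↥D.surf × Ioo (-1 : ℝ) 1) :
    ((D.bandHomeomorph U p : ↥(D.band U)) : 𝕊 3) = D.bandMap U p.1 p.2 := rfl

/-! ### The compactness lemma behind the continuity of the circle map -/

/-- **The flow-out of `closure F° × [-(1 - ε), 1 - ε]` meets the knot complement inside the
band**: a point `fl y (t · w y)` with `y ∈ closure F° ⊆ F° ∪ K` is either in the band (if
`y ∈ F°`) or the point `y ∈ K` itself (if `y ∈ K`, where the width vanishes). [folklore] -/
theorem bandMap_mem_band_of_mem_closure {y : 𝕊 3} (hy : y ∈ closure D.surf) {t : ℝ} (ht : |t| < 1)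
    (hK : D.bandMap U y t ∉ range ⇑K) : D.bandMap U y t ∈ D.band U := by
  rcases D.closure_surf_subset hy with h | h
  · exact D.bandMap_mem_band U h ht
  · exact absurd (by rw [D.bandMap_of_mem_range U h]; exact h) hK

/-- The image `Q_ε = Ψ̂ (closure F° × [-(1 - ε), 1 - ε])` is compact. [folklore] -/
theorem isCompact_image_bandMap (ε : ℝ) :
    IsCompact ((fun p : (𝕊 3) × ℝ => D.bandMap U p.1 p.2) '' (closure D.surf ×ˢ Icc (-(1 - ε)) (1 - ε))) :=
  ((D.isCompact_sheet.closure_of_subset D.surf_subset_sheet).prod isCompact_Icc).image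
    (D.continuous_bandMap U)

/-- **Points of the band of normalised height at most `1 - ε` lie in `Q_ε`.** [folklore] -/
theorem mem_image_bandMap_of_abs_le {q : 𝕊 3} (hq : q ∈ D.band U) {ε : ℝ}
    (hε : |D.sphereLevelFn q / D.width U (U.drop q)| ≤ 1 - ε) :
    q ∈ (fun p : (𝕊 3) × ℝ => D.bandMap U p.1 p.2) '' (closure D.surf ×ˢ Icc (-(1 - ε)) (1 - ε)) :=
  ⟨(U.drop q, D.sphereLevelFn q / D.width U (U.drop q)),
    ⟨subset_closure hq.2.1, abs_le.1 hε⟩, D.bandMap_drop U hq⟩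

/-- **Points of `Q_ε` off the knot lie in the band with normalised height at most `1 - ε`.**
[folklore] -/
theorem abs_le_of_mem_image_bandMap {q : 𝕊 3} {ε : ℝ} (hε : 0 < ε)
    (hq : q ∈ (fun p : (𝕊 3) × ℝ => D.bandMap U p.1 p.2) '' (closure D.surf ×ˢ Icc (-(1 - ε)) (1 - ε)))
    (hK : q ∉ range ⇑K) :
    q ∈ D.band U ∧ |D.sphereLevelFn q / D.width U (U.drop q)| ≤ 1 - ε := by
  obtain ⟨⟨y, t⟩, ⟨hy, ht⟩, rfl⟩ := hq
  have ht1 : |t| ≤ 1 - ε := abs_le.2 ht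
  have ht' : |t| < 1 := lt_of_le_of_lt ht1 (by linarith)
  have hmem := D.bandMap_mem_band_of_mem_closure U hy ht' hK
  refine ⟨hmem, ?_⟩
  rcases D.closure_surf_subset hy with h | h
  · have hy0 := D.sphereLevelFn_eq_zero_of_mem_surf h
    have hw : 0 < D.width U y := D.width_pos U (D.surf_subset_compl_range h)
    change |D.sphereLevelFn (D.bandMap U y t) / D.width U (U.drop (D.bandMap U y t))| ≤ 1 - ε
    rw [D.drop_bandMap U hy0 ht'.le, D.sphereLevelFn_bandMap U hy0 ht'.le, mul_div_cancel_right₀ _ hw.ne']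
    exact ht1
  · exact absurd (by change D.bandMap U y t ∈ range ⇑K; rw [D.bandMap_of_mem_range U h]; exact h) hK

end SeifertDatum

end Literature.Topology.FourManifolds
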